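import Mathlib
import Summits.Ventures.PercRepro2.Defs
import Summits.Ventures.PercRepro2.Graph
import Summits.Ventures.PercRepro2.OneColourSwitch
import Summits.Ventures.PercRepro2.RegionHubSign
import Summits.Ventures.PercRepro2.SideSwitch
import Summits.Ventures.PercRepro2.SideSwitchFibre
import Summits.Ventures.PercRepro2.SideSwitchComps
import Summits.Ventures.PercRepro2.TermSwitchDefs
import Summits.Ventures.PercRepro2.TermSwitchFibre
import Summits.Ventures.PercRepro2.TermSwitchMono
import Summits.Ventures.PercRepro2.TermSwitchM9
import Summits.Ventures.PercRepro2.TermSwitchRestrict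
import Summits.Ventures.PercRepro2.TermSwitchReach
import Summits.Ventures.PercRepro2.M9NoPocketDefs
import Summits.Ventures.PercRepro2.M9NoPocketWorldD
import Summits.Ventures.PercRepro2.M9PocketRepAB
import Summits.Ventures.PercRepro2.M9KOnlyStar
import Summits.Ventures.PercRepro2.M9GeneralDSplit
import Summits.Ventures.PercRepro2.M9PocketCubeDefs
import Summits.Ventures.PercRepro2.M9PocketCubeFibre
import Summits.Ventures.PercRepro2.M9ReachedSum

/-!
# The clean one-sided sum is non-positive on the no-pocket class (blind cell PercRepro2,
p3 g35, 2026-08-29; `proofs/P3-NPHDR.md` §2, Remark)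

Without a pocket (every neighbour of `d` other than `r, s` adjacent to `r` or `s`) and without
a loop at `d`, a one-sided `d` is CLEAN (`Sep_H ∧ DZero_H` for the triple `{r, s, d}`) exactly
when its star is monochromatic: all edges `Y` for `d ∈ K₂ ∖ M₂` (`clean_K_iff_star_true`), all
`W` for `d ∈ M₂ ∖ K₂`.  Hence the clean one-sided sum `L_z = cleanReachedSum` is the sum of the
two monochromatic `d`-star co-fibres, `kOnlyStarSum (fun _ => true) + mOnlyStarSum
(fun _ => false)`, and THEOREM A of `M9KOnlyStar` (every `d`-star co-fibre of the one-sided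
points is non-positive) gives **`L_z ≤ 0` on the no-pocket class**
(`cleanReachedSum_nonpos_of_noPocket`) — the conjecture `L_z ≤ 0` of `M9FourParts` on that
class.  With `L_z + EX ≤ 0` and `HD ≤ 0` (`M9NoPocketHDR`) every part of
`dSignSum = N + L_z + EX + HD` except `EX` is now non-positive there.  Own work; std axioms.
-/

namespace Summit.Ventures.PercRepro2

namespace NoPocket

open Finset Classical RegionHub OneColourSwitch SideSwitch TermSwitch

variable {V : Type*} {E : Type*}

section Clean

variable [Fintype V] [DecidableEq V] [Fintype E] [DecidableEq E] {ends : E → Sym2 V}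

omit [Fintype V] [DecidableEq V] [Fintype E] [DecidableEq E] in
/-- A vertex all of whose edges are open is alone in its closed cluster. -/
lemma conn_compl_eq_of_star_true {d : V} {ω : Config E} (h : ∀ e, d ∈ ends e → ω e = true)
    {y : V} (hc : Conn ends (OneColourSwitch.compl ω) d y) : y = d := by
  have hy : y ∈ ({d} : Set V) := by
    refine mem_of_conn_of_closed (S := ({d} : Set V)) ?_ rfl hc
    intro u hu v hadj
    rw [Set.mem_singleton_iff] at hu
    subst hu
    obtain ⟨_, e, he, hends⟩ := openGraph_adj.1 hadj
    have hd : u ∈ ends e := by rw [hends]; exact Sym2.mem_mk_left _ _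
    have := h e hd
    simp [OneColourSwitch.compl, this] at he
  exact hy

omit [Fintype V] [Fintype E] [DecidableEq E] in
/-- **Clean `K`-only means a monochromatic star** (no pocket, no loop at `d`): a `Sep ∧ DOne`
colouring with `d ∈ K₂ ∖ M₂` is `Sep_H ∧ DZero_H` for the triple `{r, s, d}` exactly when every
edge at `d` is `Y`. -/
lemma clean_K_iff_star_true {p q r s d : V} (hnp : NoPocketAt ends d r s)
    (hloop : ∀ e, ends e ≠ s(d, d)) (hpd : p ≠ d) (hqd : q ≠ d) (hr : d ≠ r) (hs : d ≠ s)
    {ω : Config E} (hsep : sep2 ends p q r s ω) (hD : DOne ends r s d ω)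
    (hK : d ∈ K2 ends r s ω) (hM : d ∉ M2 ends r s ω) :
    (sepH ends p q ({r, s, d} : Set V) ω ∧ DZeroH ends ({r, s, d} : Set V) ω) ↔
      StarEq ends d (fun _ => true) ω := by
  constructor
  · rintro ⟨_, hZ⟩ e hde
    by_contra hne
    have hW : ω e = false := by
      cases h : ω e
      · rfl
      · exact absurd h hne
    -- the other endpoint `y` of `e`
    obtain ⟨y, hends⟩ : ∃ y, ends e = s(d, y) :=
      ⟨Sym2.Mem.other hde, (Sym2.other_spec hde).symm⟩
    have hyd : y ≠ d := fun h => hloop e (by rw [hends, h])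
    have hcW : Conn ends (OneColourSwitch.compl ω) d y :=
      conn_of_openAdj ⟨e, by simp [OneColourSwitch.compl, hW], hends⟩
    by_cases hyr : y = r
    · subst hyr
      exact hM (mem_M2_iff.2 (Or.inl (conn_symm hcW)))
    by_cases hys : y = s
    · subst hys
      exact hM (mem_M2_iff.2 (Or.inr (conn_symm hcW)))
    -- `y` is a neighbour of `d`: it lies in a world of `G − d`, hence of `G`
    have hyw : y ∈ K2 ends r s ω ∨ y ∈ M2 ends r s ω := by
      rcases neighbour_mem_worlds hnp hr hs ω hends hyd hyr hys with h | h
      · exact Or.inl (K2_endsD_subset_K2 _ h)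
      · exact Or.inr (M2_endsD_subset_M2 _ h)
    rcases hyw with hyK | hyM
    · have hyH : y ∉ ({r, s, d} : Set V) := by
        simp only [Set.mem_insert_iff, Set.mem_singleton_iff, not_or]
        exact ⟨hyr, hys, hyd⟩
      exact hZ y hyH (mem_KH_triple'.2 (Or.inl hyK)) (mem_MH_triple'.2 (Or.inr hcW))
    · exact hM (mem_M2_iff.2 (by
        rcases mem_M2_iff.1 hyM with h | h
        · exact Or.inl (conn_trans h (conn_symm hcW))
        · exact Or.inr (conn_trans h (conn_symm hcW))))
  · intro hstar
    have hKH : ∀ x, x ∈ KH ends ({r, s, d} : Set V) ω → x ∈ K2 ends r s ω := by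
      intro x hx
      rcases mem_KH_triple'.1 hx with hx | hx
      · exact hx
      · rcases mem_K2_iff.1 hK with h | h
        · exact mem_K2_iff.2 (Or.inl (conn_trans h hx))
        · exact mem_K2_iff.2 (Or.inr (conn_trans h hx))
    have hMH : ∀ x, x ∈ MH ends ({r, s, d} : Set V) ω → x ∈ M2 ends r s ω ∨ x = d := by
      intro x hx
      rcases mem_MH_triple'.1 hx with hx | hx
      · exact Or.inl hx
      · exact Or.inr (conn_compl_eq_of_star_true hstar hx)
    obtain ⟨hpK, hqK⟩ := not_mem_K2_of_sep2 hsep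
    obtain ⟨hpM, hqM⟩ := not_mem_M2_of_sep2 hsep
    refine ⟨⟨fun h => hpK (hKH p h), fun h => hqK (hKH q h), ?_, ?_⟩, ?_⟩
    · intro h
      rcases hMH p h with h | h
      · exact hpM h
      · exact hpd h
    · intro h
      rcases hMH q h with h | h
      · exact hqM h
      · exact hqd h
    · intro x hxH hxK hxM
      simp only [Set.mem_insert_iff, Set.mem_singleton_iff, not_or] at hxH
      obtain ⟨hxr, hxs, hxd⟩ := hxH
      rcases hMH x hxM with h | h
      · exact hD x hxr hxs hxd (hKH x hxK) h
      · exact hxd h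

omit [Fintype V] [Fintype E] [DecidableEq E] in
/-- The mirror: clean `M`-only means every edge at `d` is `W`. -/
lemma clean_M_iff_star_false {p q r s d : V} (hnp : NoPocketAt ends d r s)
    (hloop : ∀ e, ends e ≠ s(d, d)) (hpd : p ≠ d) (hqd : q ≠ d) (hr : d ≠ r) (hs : d ≠ s)
    {ω : Config E} (hsep : sep2 ends p q r s ω) (hD : DOne ends r s d ω)
    (hM : d ∈ M2 ends r s ω) (hK : d ∉ K2 ends r s ω) :
    (sepH ends p q ({r, s, d} : Set V) ω ∧ DZeroH ends ({r, s, d} : Set V) ω) ↔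
      StarEq ends d (fun _ => false) ω := by
  have hK' : d ∈ K2 ends r s (OneColourSwitch.compl ω) := by rw [K2_compl]; exact hM
  have hM' : d ∉ M2 ends r s (OneColourSwitch.compl ω) := by rw [M2_compl]; exact hK
  have h := clean_K_iff_star_true hnp hloop hpd hqd hr hs (sep2_compl.2 hsep) (DOne_compl hD)
    hK' hM'
  rw [sepH_compl] at h
  have hZ : DZeroH ends ({r, s, d} : Set V) (OneColourSwitch.compl ω) ↔
      DZeroH ends ({r, s, d} : Set V) ω :=
    ⟨fun h' => by simpa using DZeroH_compl h', DZeroH_compl⟩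
  rw [hZ] at h
  rw [h]
  constructor
  · intro hst e hde
    have := hst e hde
    simpa [OneColourSwitch.compl] using this
  · intro hst e hde
    have := hst e hde
    simp [OneColourSwitch.compl, this]

/-- **`L_z ≤ 0` on the no-pocket class** (no loop at `d`): the clean one-sided sum is the sum
of the two monochromatic `d`-star co-fibres, each non-positive by THEOREM A. -/
theorem cleanReachedSum_nonpos_of_noPocket {p q r s d : V} (hnp : NoPocketAt ends d r s)
    (hloop : ∀ e, ends e ≠ s(d, d)) (hpd : p ≠ d) (hqd : q ≠ d) (hr : d ≠ r) (hs : d ≠ s) :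
    cleanReachedSum ends p q r s d ≤ 0 := by
  have hsplit : cleanReachedSum ends p q r s d =
      kOnlyStarSum ends p q r s d (fun _ => true) + mOnlyStarSum ends p q r s d (fun _ => false) := by
    unfold cleanReachedSum kOnlyStarSum mOnlyStarSum
    rw [← Finset.sum_add_distrib]
    refine Finset.sum_congr rfl (fun ω _ => ?_)
    by_cases h0 : sep2 ends p q r s ω ∧ DOne ends r s d ω
    · obtain ⟨hsep, hD⟩ := h0
      by_cases hK : d ∈ K2 ends r s ω <;> by_cases hM : d ∈ M2 ends r s ω
      · -- doubly reached: not one-sided, in no co-fibre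
        have h1 : ¬ (sep2 ends p q r s ω ∧ DOne ends r s d ω ∧ OneSided ends r s d ω ∧
            (sepH ends p q ({r, s, d} : Set V) ω ∧ DZeroH ends ({r, s, d} : Set V) ω)) :=
          fun h => h.2.2.1.2 ⟨hK, hM⟩
        rw [if_neg h1, if_neg (fun h => h.2.2.1.2 hM), if_neg (fun h => h.2.2.1.2 hK)]
        simp
      · have hiff := clean_K_iff_star_true hnp hloop hpd hqd hr hs hsep hD hK hM
        by_cases hc : sepH ends p q ({r, s, d} : Set V) ω ∧ DZeroH ends ({r, s, d} : Set V) ω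
        · rw [if_pos ⟨hsep, hD, ⟨Or.inl hK, fun h => hM h.2⟩, hc⟩,
            if_pos ⟨hsep, hD, ⟨hK, hM⟩, hiff.1 hc⟩, if_neg (fun h => hM h.2.2.1.1)]
          simp
        · rw [if_neg (fun h => hc h.2.2.2), if_neg (fun h => hc (hiff.2 h.2.2.2)),
            if_neg (fun h => hM h.2.2.1.1)]
          simp
      · have hiff := clean_M_iff_star_false hnp hloop hpd hqd hr hs hsep hD hM hK
        by_cases hc : sepH ends p q ({r, s, d} : Set V) ω ∧ DZeroH ends ({r, s, d} : Set V) ω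
        · rw [if_pos ⟨hsep, hD, ⟨Or.inr hM, fun h => hK h.1⟩, hc⟩,
            if_neg (fun h => hK h.2.2.1.1), if_pos ⟨hsep, hD, ⟨hM, hK⟩, hiff.1 hc⟩]
          simp
        · rw [if_neg (fun h => hc h.2.2.2), if_neg (fun h => hK h.2.2.1.1),
            if_neg (fun h => hc (hiff.2 h.2.2.2))]
          simp
      · -- unreached: not one-sided, in no co-fibre
        rw [if_neg (fun h => (h.2.2.1.1.elim hK hM)), if_neg (fun h => hK h.2.2.1.1),
          if_neg (fun h => hM h.2.2.1.1)]
        simp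
    · rw [if_neg (fun h => h0 ⟨h.1, h.2.1⟩), if_neg (fun h => h0 ⟨h.1, h.2.1⟩),
        if_neg (fun h => h0 ⟨h.1, h.2.1⟩)]
      simp
  rw [hsplit]
  have h1 := kOnlyStarSum_nonpos (ends := ends) (p := p) (q := q) hr hs (fun _ => true)
  have h2 := mOnlyStarSum_nonpos (ends := ends) (p := p) (q := q) hr hs (fun _ => false)
  linarith

end Clean

end NoPocket

end Summit.Ventures.PercRepro2
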